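import Summits.HodgeConjecture.HodgeConjecture.Theses.HeckePrymWeil
import Literature.AlgebraicGeometry.HodgeTheory.HodgeTypeConjugation
import Literature.AlgebraicGeometry.HodgeTheory.CupPreservesHodgeTypeOfDeRham
import Literature.AlgebraicGeometry.HodgeTheory.GysinFormalismHodgeOfGysin
import Literature.AlgebraicTopology.SingularHomology.CupProductExteriorH1
import Literature.NumberTheory.Transcendental.DeRhamTheoremMultiplicative
import HarnessLib

/-!
# Crux `WeilTwelvefoldsSqrtMinus7` (stmt-HodgeConjecture-1261), line `amnesic-secant-sheaves-split-fourteenfolds` — lemmas for stub `stub_weilMultiplicity` (α₁, r6)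

Helper file of the stub `stub_weilMultiplicity` (Weil multiplicities `(n, n)` from the Weil class;
B. Moonen, Yu. Zarhin, J. reine angew. Math. 496 (1998), Criterion; B. van Geemen, LNM 1594 (1994),
Lemma 5.2 (6)), on the tree's real carriers `complexBetti X k = Hᵏ(X(ℂ); ℂ)`:

* the Hodge pieces `(M^*)⁻¹ H^{p,q} ⊆ Hᵏ(X(ℂ); ℂ)` cut out by a FIXED Hodge model `M`
  (`(M.hodgePQ k p q).comap (M.pullback k)`): they are the transport of the de Rham pieces along
  the isomorphism `(M^*)⁻¹ ∘ e` (`comap_hodgePQ_eq_orderIsoMapComap`), hence independent and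
  spanning (`iSupIndep_comap_hodgePQ`, `iSup_comap_hodgePQ_eq_top`: the Hodge decomposition
  `isInternal_hodgePQ` of the model); a non-zero class has at most one type
  (`hodgeType_unique_of_ne_zero`, `eq_zero_of_mem_of_eq_add`); conjugation exchanges `(p, q)` and
  `(q, p)` (`conjClass_mem_comap_hodgePQ`, every model being Hodge symmetric); types add under the
  iterated cup product of degree-one classes (`cupPowOne_mem_comap_hodgePQ`, the registered
  sub-goal: `cupPreservesHodgeType_of_exists_deRhamIsoFamily` with de Rham's theorem);
* linear algebra: an eigenspace splits along a stable complementary pair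
  (`eigenspace_eq_inf_sup_inf`, `finrank_eigenspace_eq_add`) and bases of `V = E ⊕ E'` adapted to
  `E = (E ∩ P) ⊕ (E ∩ Q)` (`exists_basis_adapted`).

Everything is proved; no named fact is taken.
-/

noncomputable section

set_option linter.dupNamespace false

open CategoryTheory Complex
open Literature.AlgebraicGeometry Literature.AlgebraicGeometry.Motives
  Literature.AlgebraicGeometry.HodgeTheory Literature.AlgebraicTopology.SingularHomology

namespace Summit.HodgeConjecture.HodgeConjecture.Theorems.WeilTwelvefoldsSqrtMinus7.AmnesicSecantSheaves

/-! ## The Hodge pieces `H^{p,q} ⊆ Hᵏ(X(ℂ); ℂ)` cut out by a fixed Hodge model -/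

section HodgePieces

variable {m : ℕ} {X : SchemeOver ℂ}

/-- The pieces `(M^*)⁻¹ H^{p,q} ⊆ Hᵏ(X(ℂ); ℂ)` of a Hodge model are the images of the de Rham
pieces `H^{p,q}_dR` under the isomorphism `(M^*)⁻¹ ∘ e : H^k_dR(X^an) ≅ Hᵏ(X(ℂ); ℂ)` (`e` the de Rham
comparison, `M^*` the bijective pull-back). [cite: VoisinHodgeI2002, §6.1.3 and §7.1.1] -/
theorem comap_hodgePQ_eq_orderIsoMapComap (M : HodgeModel m X) (k p q : ℕ) :
    (M.hodgePQ k p q).comap (M.pullback k).hom =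
      Submodule.orderIsoMapComap ((M.deRham M.carrier k).trans
        (LinearEquiv.ofBijective (M.pullback k).hom ⟨M.pullback_injective k, M.pullback_surjective k⟩).symm)
        (Literature.NumberTheory.Transcendental.hodgePQ M.model M.carrier k p q) := by
  ext x
  rw [Submodule.orderIsoMapComap_apply, Submodule.mem_map, Submodule.mem_comap, HodgeModel.hodgePQ,
    Submodule.mem_map]
  constructor
  · rintro ⟨w, hw, hwx⟩
    refine ⟨w, hw, ?_⟩
    rw [LinearEquiv.coe_coe, LinearEquiv.trans_apply, LinearEquiv.symm_apply_eq,
      LinearEquiv.ofBijective_apply]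
    exact hwx
  · rintro ⟨w, hw, hwx⟩
    refine ⟨w, hw, ?_⟩
    rw [LinearEquiv.coe_coe, LinearEquiv.trans_apply, LinearEquiv.symm_apply_eq,
      LinearEquiv.ofBijective_apply] at hwx
    exact hwx

/-- **The transported pieces are independent** (the Hodge decomposition of the model, field
`isInternal_hodgePQ`, transported along `(M^*)⁻¹ ∘ e`). [cite: VoisinHodgeI2002, Thm. 6.18 and §7.1.1] -/
theorem iSupIndep_comap_hodgePQ (M : HodgeModel m X) (k : ℕ) :
    iSupIndep fun pq : ↥(Finset.HasAntidiagonal.antidiagonal k) ↦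
      (M.hodgePQ k pq.1.1 pq.1.2).comap (M.pullback k).hom := by
  have h := (M.isInternal_hodgePQ k).submodule_iSupIndep
  have hcomp : (fun pq : ↥(Finset.HasAntidiagonal.antidiagonal k) ↦ (M.hodgePQ k pq.1.1 pq.1.2).comap (M.pullback k).hom) =
      (Submodule.orderIsoMapComap ((M.deRham M.carrier k).trans
        (LinearEquiv.ofBijective (M.pullback k).hom ⟨M.pullback_injective k, M.pullback_surjective k⟩).symm)) ∘
        fun pq : ↥(Finset.HasAntidiagonal.antidiagonal k) ↦
          Literature.NumberTheory.Transcendental.hodgePQ M.model M.carrier k pq.1.1 pq.1.2 := by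
    funext pq
    rw [Function.comp_apply, comap_hodgePQ_eq_orderIsoMapComap]
  rw [hcomp, iSupIndep_map_orderIso_iff]
  exact h

/-- **The transported pieces span `Hᵏ(X(ℂ); ℂ)`** (same transport). [cite: VoisinHodgeI2002, Thm. 6.18 and §7.1.1] -/
theorem iSup_comap_hodgePQ_eq_top (M : HodgeModel m X) (k : ℕ) :
    ⨆ pq : ↥(Finset.HasAntidiagonal.antidiagonal k), (M.hodgePQ k pq.1.1 pq.1.2).comap (M.pullback k).hom = ⊤ := by
  have h := (M.isInternal_hodgePQ k).submodule_iSup_eq_top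
  simp_rw [comap_hodgePQ_eq_orderIsoMapComap]
  rw [← OrderIso.map_iSup, h, OrderIso.map_top]

/-- **A non-zero class has at most one Hodge type** in a fixed model: if `c ≠ 0` lies in the pieces
`(p, q)` and `(p', q')` of `Hᵏ`, then `(p, q) = (p', q')` ("a class of two different types is zero";
pieces off the antidiagonal vanish, `hodgePQ_eq_bot_of_ne`). [cite: VoisinHodgeI2002, Cor. 6.14] -/
theorem hodgeType_unique_of_ne_zero (M : HodgeModel m X) {k p q p' q' : ℕ} {c : complexBetti X k}
    (hc : c ∈ (M.hodgePQ k p q).comap (M.pullback k).hom)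
    (hc' : c ∈ (M.hodgePQ k p' q').comap (M.pullback k).hom) (h0 : c ≠ 0) : (p, q) = (p', q') := by
  -- both types lie on the antidiagonal (else the piece is `⊥`)
  have hpq : p + q = k := by
    by_contra hne
    have hbot : M.hodgePQ k p q = ⊥ :=
      (M.hodgePQ_eq_bot_iff k p q).2 (Literature.NumberTheory.Transcendental.hodgePQ_eq_bot_of_ne hne)
    rw [Submodule.mem_comap, hbot, Submodule.mem_bot] at hc
    exact h0 (M.pullback_injective k (by rw [hc, map_zero]))
  have hpq' : p' + q' = k := by
    by_contra hne
    have hbot : M.hodgePQ k p' q' = ⊥ :=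
      (M.hodgePQ_eq_bot_iff k p' q').2 (Literature.NumberTheory.Transcendental.hodgePQ_eq_bot_of_ne hne)
    rw [Submodule.mem_comap, hbot, Submodule.mem_bot] at hc'
    exact h0 (M.pullback_injective k (by rw [hc', map_zero]))
  by_contra hne
  let i : ↥(Finset.HasAntidiagonal.antidiagonal k) := ⟨(p, q), Finset.HasAntidiagonal.mem_antidiagonal.2 hpq⟩
  let i' : ↥(Finset.HasAntidiagonal.antidiagonal k) := ⟨(p', q'), Finset.HasAntidiagonal.mem_antidiagonal.2 hpq'⟩
  have hii' : i ≠ i' := fun h ↦ hne (congrArg Subtype.val h)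
  have hdisj := (iSupIndep_comap_hodgePQ M k).pairwiseDisjoint hii'
  rw [Function.onFun, Submodule.disjoint_def] at hdisj
  exact h0 (hdisj c hc hc')

/-- **A class of type `(p₀, q₀)` which is a sum of classes of types different from `(p₀, q₀)` is
zero** (independence of the pieces: `H^{p₀,q₀} ∩ ⨆_{(p,q) ≠ (p₀,q₀)} H^{p,q} = 0`).
[cite: VoisinHodgeI2002, Cor. 6.14] -/
theorem eq_zero_of_mem_of_eq_add (M : HodgeModel m X) {k p₀ q₀ p q p' q' : ℕ}
    {c x y : complexBetti X k} (hc : c ∈ (M.hodgePQ k p₀ q₀).comap (M.pullback k).hom)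
    (hx : x ∈ (M.hodgePQ k p q).comap (M.pullback k).hom)
    (hy : y ∈ (M.hodgePQ k p' q').comap (M.pullback k).hom) (hxy : c = x + y)
    (hp : (p, q) ≠ (p₀, q₀)) (hp' : (p', q') ≠ (p₀, q₀)) (h₀ : p₀ + q₀ = k) : c = 0 := by
  -- replace off-antidiagonal summands by `0`
  have key : ∀ {r s : ℕ} {z : complexBetti X k}, z ∈ (M.hodgePQ k r s).comap (M.pullback k).hom →
      (r, s) ≠ (p₀, q₀) →
      z ∈ ⨆ (i : ↥(Finset.HasAntidiagonal.antidiagonal k)) (_ : i ≠ ⟨(p₀, q₀), Finset.HasAntidiagonal.mem_antidiagonal.2 h₀⟩),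
        (M.hodgePQ k i.1.1 i.1.2).comap (M.pullback k).hom := by
    intro r s z hz hrs
    by_cases hsum : r + s = k
    · exact (le_iSup₂_of_le (f := fun (i : ↥(Finset.HasAntidiagonal.antidiagonal k))
          (_ : i ≠ ⟨(p₀, q₀), Finset.HasAntidiagonal.mem_antidiagonal.2 h₀⟩) ↦ (M.hodgePQ k i.1.1 i.1.2).comap (M.pullback k).hom)
        ⟨(r, s), Finset.HasAntidiagonal.mem_antidiagonal.2 hsum⟩ (fun h ↦ hrs (congrArg Subtype.val h)) le_rfl) hz
    · have hbot : M.hodgePQ k r s = ⊥ :=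
        (M.hodgePQ_eq_bot_iff k r s).2 (Literature.NumberTheory.Transcendental.hodgePQ_eq_bot_of_ne hsum)
      rw [Submodule.mem_comap, hbot, Submodule.mem_bot] at hz
      have hz0 : z = 0 := M.pullback_injective k (by rw [hz, map_zero])
      rw [hz0]
      exact Submodule.zero_mem _
  have hdisj := (iSupIndep_def.1 (iSupIndep_comap_hodgePQ M k)) ⟨(p₀, q₀), Finset.HasAntidiagonal.mem_antidiagonal.2 h₀⟩
  rw [Submodule.disjoint_def] at hdisj
  refine hdisj c hc ?_
  rw [hxy]
  exact Submodule.add_mem _ (key hx hp) (key hy hp')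

/-- Conjugation exchanges the pieces `(p, q)` and `(q, p)` of `Hᵏ(X(ℂ); ℂ)` cut out by ANY Hodge
model of a smooth projective `X` (`HodgeModel.isHodgeSymmetric`, `HodgeModel.pullback_conjClass`).
[cite: VoisinHodgeI2002, §6.1.3 Cor. 6.12] -/
theorem conjClass_mem_comap_hodgePQ (M : HodgeModel m X) (hX : IsSmoothProjective m X) {k p q : ℕ}
    {c : complexBetti X k} (hc : c ∈ (M.hodgePQ k p q).comap (M.pullback k).hom) :
    conjClass (ComplexPoints X) k c ∈ (M.hodgePQ k q p).comap (M.pullback k).hom := by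
  rw [Submodule.mem_comap] at hc ⊢
  change M.pullback k (conjClass (ComplexPoints X) k c) ∈ M.hodgePQ k q p
  rw [M.pullback_conjClass]
  exact M.isHodgeSymmetric hX k p q _ hc

/-- **Types add under the iterated cup product of degree-one classes** (registered sub-goal, helper
for `stub_weilMultiplicity`): if `vᵢ ∈ H¹(X(ℂ); ℂ)` has type `(pᵢ, qᵢ)` in the Hodge model `M` of the
smooth projective `X`, then `v₀ ⌣ ⋯ ⌣ v_{d-1}` has type `(Σ pᵢ, Σ qᵢ)` in `M` (the cup product
preserves Hodge types, `cupPreservesHodgeType_of_exists_deRhamIsoFamily` with de Rham's theorem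
`exists_deRhamIsoFamily_holds`; `1` is of type `(0,0)`, `isOfHodgeType_zero_zero_zero`; everything
read in the fixed model `M` by `isOfHodgeType_iff_mem_hodgePQ`).
[cite: VoisinHodgeI2002, §5.3.2 Thm. 5.29 and §7.1.2] -/
theorem cupPowOne_mem_comap_hodgePQ :
    ∀ (m : ℕ) (X : SchemeOver ℂ) (M : HodgeModel m X), IsSmoothProjective m X →
    ∀ (d : ℕ) (v : Fin d → complexBetti X 1) (p q : Fin d → ℕ),
      (∀ i, v i ∈ (M.hodgePQ 1 (p i) (q i)).comap (M.pullback 1).hom) →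
      cupPowOne ℂ (ComplexPoints X) d v ∈ (M.hodgePQ d (∑ i, p i) (∑ i, q i)).comap (M.pullback d).hom := by
  intro m X M hX d
  have hcup : CupPreservesHodgeType m X :=
    cupPreservesHodgeType_of_exists_deRhamIsoFamily hodgePQ_independent_of_hodgeModel_holds hX M
      (Literature.NumberTheory.Transcendental.exists_deRhamIsoFamily_holds M.model)
  induction d with
  | zero =>
    intro v p q _
    rw [Submodule.mem_comap, Fin.sum_univ_zero, Fin.sum_univ_zero]
    exact (isOfHodgeType_iff_mem_hodgePQ hX M _).1 (isOfHodgeType_zero_zero_zero M _)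
  | succ d ih =>
    intro v p q hv
    rw [Submodule.mem_comap, cupPowOne_succ, Fin.sum_univ_succ, Fin.sum_univ_succ]
    refine (isOfHodgeType_iff_mem_hodgePQ hX M _).1 (hcup (Nat.add_comm 1 d) ?_ ?_)
    · exact (isOfHodgeType_iff_mem_hodgePQ hX M _).2 (hv 0)
    · exact (isOfHodgeType_iff_mem_hodgePQ hX M _).2
        (ih (Fin.tail v) (fun i ↦ p i.succ) (fun i ↦ q i.succ) fun i ↦ hv i.succ)

end HodgePieces


/-! ## Linear algebra: eigenspaces along a stable complementary pair; adapted bases -/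

section LinearAlgebra

variable {K V : Type*} [Field K] [AddCommGroup V] [Module K V]

/-- **An eigenspace splits along a stable complementary pair**: if `V = P ⊕ Q` with `T P ⊆ P`,
`T Q ⊆ Q`, then `Eig(T, μ) = (Eig(T, μ) ∩ P) ⊕ (Eig(T, μ) ∩ Q)` (the two components of an
eigenvector are eigenvectors). [folklore] -/
theorem eigenspace_eq_inf_sup_inf (T : V →ₗ[K] V) {P Q : Submodule K V} (hPQ : IsCompl P Q)
    (hP : ∀ v ∈ P, T v ∈ P) (hQ : ∀ v ∈ Q, T v ∈ Q) (μ : K) :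
    Module.End.eigenspace T μ =
      (Module.End.eigenspace T μ ⊓ P) ⊔ (Module.End.eigenspace T μ ⊓ Q) := by
  refine le_antisymm (fun v hv ↦ ?_) (sup_le inf_le_left inf_le_left)
  have hv' := Module.End.mem_eigenspace_iff.1 hv
  have htop : v ∈ P ⊔ Q := by rw [hPQ.sup_eq_top]; exact Submodule.mem_top
  obtain ⟨p, hp, q, hq, rfl⟩ := Submodule.mem_sup.1 htop
  -- `(T p - μ p) + (T q - μ q) = 0` with summands in `P`, `Q`
  have hsum : (T p - μ • p) + (T q - μ • q) = 0 := by
    rw [map_add, smul_add] at hv'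
    calc (T p - μ • p) + (T q - μ • q) = (T p + T q) - (μ • p + μ • q) := by abel
      _ = 0 := by rw [hv', sub_self]
  have h1 : T p - μ • p ∈ P := P.sub_mem (hP p hp) (P.smul_mem μ hp)
  have h2 : T q - μ • q ∈ Q := Q.sub_mem (hQ q hq) (Q.smul_mem μ hq)
  have h1' : T p - μ • p ∈ Q := by
    have e : T p - μ • p = -(T q - μ • q) := eq_neg_of_add_eq_zero_left hsum
    rw [e]; exact Q.neg_mem h2
  have hp0 : T p - μ • p = 0 := (Submodule.disjoint_def.1 hPQ.disjoint) _ h1 h1'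
  have hq0 : T q - μ • q = 0 := by rwa [hp0, zero_add] at hsum
  refine Submodule.add_mem _ (Submodule.mem_sup_left ⟨?_, hp⟩) (Submodule.mem_sup_right ⟨?_, hq⟩)
  · exact Module.End.mem_eigenspace_iff.2 (sub_eq_zero.1 hp0)
  · exact Module.End.mem_eigenspace_iff.2 (sub_eq_zero.1 hq0)

/-- Dimension count for the previous splitting:
`dim Eig(T, μ) = dim (Eig(T, μ) ∩ P) + dim (Eig(T, μ) ∩ Q)`. [folklore] -/
theorem finrank_eigenspace_eq_add [FiniteDimensional K V] (T : V →ₗ[K] V) {P Q : Submodule K V}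
    (hPQ : IsCompl P Q) (hP : ∀ v ∈ P, T v ∈ P) (hQ : ∀ v ∈ Q, T v ∈ Q) (μ : K) :
    Module.finrank K ↥(Module.End.eigenspace T μ) =
      Module.finrank K ↥(Module.End.eigenspace T μ ⊓ P) + Module.finrank K ↥(Module.End.eigenspace T μ ⊓ Q) := by
  have h := Submodule.finrank_sup_add_finrank_inf_eq (Module.End.eigenspace T μ ⊓ P)
    (Module.End.eigenspace T μ ⊓ Q)
  have hbot : (Module.End.eigenspace T μ ⊓ P) ⊓ (Module.End.eigenspace T μ ⊓ Q) = ⊥ :=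
    le_bot_iff.1 ((inf_le_inf inf_le_right inf_le_right).trans (le_bot_iff.2 hPQ.inf_eq_bot))
  rw [← eigenspace_eq_inf_sup_inf T hPQ hP hQ μ, hbot, finrank_bot, add_zero] at h
  exact h

/-- **Adapted bases.** Let `V = E ⊕ E'` and `E = (E ∩ P) ⊕ (E ∩ Q)` (`P ∩ Q = 0`), with
`dim (E ∩ P) + dim (E ∩ Q) = m`. Then `V` has a basis indexed by `Fin (m + r)` whose first `m`
vectors lie in `E`, each tagged `(pᵢ, qᵢ) = (1, 0)` and lying in `P` or tagged `(0, 1)` and lying in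
`Q`, with `Σ pᵢ = dim (E ∩ P)` and `Σ qᵢ = dim (E ∩ Q)`. [folklore] -/
theorem exists_basis_adapted [FiniteDimensional K V] {E E' P Q : Submodule K V} (hEE' : IsCompl E E')
    (hE : E = (E ⊓ P) ⊔ (E ⊓ Q)) (hPQ : Disjoint P Q) {m : ℕ}
    (hm : Module.finrank K ↥(E ⊓ P) + Module.finrank K ↥(E ⊓ Q) = m) :
    ∃ (r : ℕ) (b : Module.Basis (Fin (m + r)) K V) (p q : Fin m → ℕ),
      (∀ i, b (Fin.castAdd r i) ∈ E) ∧
      (∀ i, (p i = 1 ∧ q i = 0 ∧ b (Fin.castAdd r i) ∈ P) ∨ (p i = 0 ∧ q i = 1 ∧ b (Fin.castAdd r i) ∈ Q)) ∧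
      ∑ i, p i = Module.finrank K ↥(E ⊓ P) ∧ ∑ i, q i = Module.finrank K ↥(E ⊓ Q) := by
  classical
  -- the two pieces seen inside `E`
  set P' : Submodule K ↥E := P.comap E.subtype with hP'
  set Q' : Submodule K ↥E := Q.comap E.subtype with hQ'
  have hc' : IsCompl P' Q' := by
    constructor
    · rw [Submodule.disjoint_def]
      intro x hx hx'
      have h0 : (x : V) = 0 := (Submodule.disjoint_def.1 hPQ) _ hx hx'
      exact Subtype.ext h0
    · rw [codisjoint_iff, eq_top_iff]
      rintro ⟨x, hxE⟩ -
      have hx : x ∈ (E ⊓ P) ⊔ (E ⊓ Q) := hE ▸ hxE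
      obtain ⟨y, hy, z, hz, hyz⟩ := Submodule.mem_sup.1 hx
      have e : (⟨x, hxE⟩ : ↥E) = ⟨y, hy.1⟩ + ⟨z, hz.1⟩ := Subtype.ext hyz.symm
      rw [e]
      exact Submodule.add_mem _ (Submodule.mem_sup_left (show (⟨y, hy.1⟩ : ↥E) ∈ P' from hy.2))
        (Submodule.mem_sup_right (show (⟨z, hz.1⟩ : ↥E) ∈ Q' from hz.2))
  have hfP : Module.finrank K ↥P' = Module.finrank K ↥(E ⊓ P) := by
    rw [← Submodule.finrank_map_subtype_eq E P', Submodule.map_comap_subtype]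
  have hfQ : Module.finrank K ↥Q' = Module.finrank K ↥(E ⊓ Q) := by
    rw [← Submodule.finrank_map_subtype_eq E Q', Submodule.map_comap_subtype]
  set a := Module.finrank K ↥(E ⊓ P) with ha
  set a' := Module.finrank K ↥(E ⊓ Q) with ha'
  let bP : Module.Basis (Fin a) K ↥P' := Module.finBasisOfFinrankEq K ↥P' hfP
  let bQ : Module.Basis (Fin a') K ↥Q' := Module.finBasisOfFinrankEq K ↥Q' hfQ
  -- the tag of an index of `Fin m ≃ Fin a ⊕ Fin a'`
  let σ : Fin m ≃ Fin a ⊕ Fin a' := (finSumFinEquiv.trans (finCongr hm)).symm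
  let bE : Module.Basis (Fin m) K ↥E := ((bP.prod bQ).map (Submodule.prodEquivOfIsCompl P' Q' hc')).reindex σ.symm
  have hbE : ∀ i, (σ i).elim (fun k ↦ bE i = ((bP k : ↥P') : ↥E)) (fun k ↦ bE i = ((bQ k : ↥Q') : ↥E)) := by
    intro i
    have e : bE i = ((bP.prod bQ).map (Submodule.prodEquivOfIsCompl P' Q' hc')) (σ i) := by
      rw [Module.Basis.reindex_apply, Equiv.symm_symm]
    generalize σ i = j at e ⊢
    rcases j with k | k
    · simp only [Sum.elim_inl, e, Module.Basis.map_apply, Module.Basis.prod_apply, Function.comp_apply,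
        LinearMap.inl_apply, Submodule.coe_prodEquivOfIsCompl', Submodule.coe_zero, add_zero]
    · simp only [Sum.elim_inr, e, Module.Basis.map_apply, Module.Basis.prod_apply, Function.comp_apply,
        LinearMap.inr_apply, Submodule.coe_prodEquivOfIsCompl', Submodule.coe_zero, zero_add]
  -- a basis of the complement and the assembled basis of `V`
  set r := Module.finrank K ↥E' with hr
  let bE' : Module.Basis (Fin r) K ↥E' := Module.finBasisOfFinrankEq K ↥E' rfl
  let b : Module.Basis (Fin (m + r)) K V :=
    ((bE.prod bE').map (Submodule.prodEquivOfIsCompl E E' hEE')).reindex finSumFinEquiv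
  have hb : ∀ i, b (Fin.castAdd r i) = (bE i : V) := by
    intro i
    rw [Module.Basis.reindex_apply, finSumFinEquiv_symm_apply_castAdd]
    simp only [Module.Basis.map_apply, Module.Basis.prod_apply, Sum.elim_inl, Function.comp_apply,
      LinearMap.inl_apply, Submodule.coe_prodEquivOfIsCompl', Submodule.coe_zero, add_zero]
  let p : Fin m → ℕ := fun i ↦ (σ i).elim (fun _ ↦ 1) (fun _ ↦ 0)
  let q : Fin m → ℕ := fun i ↦ (σ i).elim (fun _ ↦ 0) (fun _ ↦ 1)
  refine ⟨r, b, p, q, fun i ↦ by rw [hb]; exact (bE i).2, fun i ↦ ?_, ?_, ?_⟩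
  · have h := hbE i
    change ((σ i).elim (fun _ ↦ 1) (fun _ ↦ 0) = 1 ∧ (σ i).elim (fun _ ↦ 0) (fun _ ↦ 1) = 0 ∧ _) ∨
      ((σ i).elim (fun _ ↦ 1) (fun _ ↦ 0) = 0 ∧ (σ i).elim (fun _ ↦ 0) (fun _ ↦ 1) = 1 ∧ _)
    rw [hb]
    generalize σ i = j at h ⊢
    rcases j with k | k
    · rw [Sum.elim_inl] at h
      refine Or.inl ⟨rfl, rfl, ?_⟩
      rw [h]
      exact (bP k).2
    · rw [Sum.elim_inr] at h
      refine Or.inr ⟨rfl, rfl, ?_⟩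
      rw [h]
      exact (bQ k).2
  · change ∑ i, (σ i).elim (fun _ ↦ 1) (fun _ ↦ 0) = a
    rw [Equiv.sum_comp σ (fun j : Fin a ⊕ Fin a' ↦ j.elim (fun _ ↦ (1 : ℕ)) (fun _ ↦ 0))]
    simp
  · change ∑ i, (σ i).elim (fun _ ↦ 0) (fun _ ↦ 1) = a'
    rw [Equiv.sum_comp σ (fun j : Fin a ⊕ Fin a' ↦ j.elim (fun _ ↦ (0 : ℕ)) (fun _ ↦ 1))]
    simp

end LinearAlgebra

end Summit.HodgeConjecture.HodgeConjecture.Theorems.WeilTwelvefoldsSqrtMinus7.AmnesicSecantSheaves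

end
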